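import Literature.NumberTheory.Transcendental.EulerLehmerConstantsTranscendence
import Literature.NumberTheory.LFunctions.EulerLehmerConstants
import HarnessLib

/-!
# Murty–Saradha 2010, Theorem 1: at most one Euler–Lehmer constant is algebraic; Corollary 2

Topic `Literature/NumberTheory/Transcendental`. Proofs only (no definitions, no named facts); sequel
of `EulerLehmerConstantsTranscendence.lean` (the engines `two_mul_eq_of_isAlgebraic`,
`div_eq_div_of_isAlgebraic` and Theorem 4).

M. Ram Murty and N. Saradha, *Euler–Lehmer constants and a conjecture of Erdős*, J. Number Theory
130 (2010) 2671–2682 [MurtySaradha2010]: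

* «**Theorem 1.** At most one number in the infinite list of numbers `γ(a,q)`, `1 ≤ a < q`, `q ≥ 2`,
  is an algebraic number. Further, if `γ` is algebraic, then only the number `γ(2,4) = γ/4` from the
  above list is algebraic.» Here `γ(a,q)` is the VALUE `−(ψ(a/q) + log q)/q` (Lehmer; proof of
  Lemma 8 in the source) — `eq_of_isAlgebraic_eulerLehmer`, `eq_two_four_of_isAlgebraic`,
  `eulerLehmer_two_four` — and, in the printed shape, the LIMIT of
  `Σ_{n ≤ M, n ≡ a (q)} 1/n − (log M)/q` (P1 g56's `EulerLehmer.tendsto_sum_inv_sub_log_div`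
  identifies it) — `eq_of_tendsto_of_isAlgebraic`.
* «**Corollary 2.** As `x` ranges over all rational numbers with `0 < x ≤ 1`, at least one of
  `Γ(x)`, `Γ′(x)` is transcendental, with at most one possible exceptional `x`.» —
  `eq_of_isAlgebraic_Gamma_deriv_Gamma` (over Mathlib's real `Γ` and `deriv Γ`), through
  `ψ = Γ′/Γ` and the two digamma statements of §4: `ψ(a/q) + γ` is transcendental for EVERY
  `1 ≤ a < q` (`transcendental_digamma_add_eulerMascheroni'`; the tree's
  `BakerBirchWirsing.transcendental_digamma_add_eulerMascheroni`, Murty–Rath Thm 22.8, P1 g55, has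
  the hypothesis `(a,q) = 1`), and `ψ(a/q) − ψ(b/r)` is transcendental unless `a/q = b/r`
  (`transcendental_digamma_sub_digamma'`; all moduli at once — cf. Chatterjee–Gun, Acta Arith. 162
  (2014), Thm 1.2, and Murty–Saradha 2007).

Cell pub-zeta5 (HONEST FRAMING: systematic search; no irrationality claim unless certified): a
printed 2010 theorem made a kernel theorem on the tree's proved Baker theorem; nothing here
concerns `ζ(5)` or decides the arithmetic nature of `γ`.
-/

noncomputable section

open Complex Finset Filter Topology
open Literature.NumberTheory.Automorphic (digammaReal)
open Literature.NumberTheory.Automorphic.LegendreP (hasDerivAt_Gamma_digammaReal)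

namespace Literature.NumberTheory.Transcendental

namespace MurtySaradha2010

/-- `ψ(a/q)` (Mathlib's complex digamma at the real point `a/q`, `1 ≤ a`, `0 < q`) is the real
number `digammaReal (a/q)`. [folklore] -/
private theorem digamma_div_natCast' {a q : ℕ} (ha : 1 ≤ a) (hq : 0 < q) :
    Complex.digamma ((a : ℂ) / q) = ((digammaReal ((a : ℝ) / q) : ℝ) : ℂ) := by
  rw [← Literature.NumberTheory.Automorphic.LegendreP.digamma_ofReal_eq_digammaReal
    (div_pos (by exact_mod_cast ha) (by exact_mod_cast hq))]
  push_cast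
  rfl

/-! ### Theorem 1: at most one `γ(a,q) = −(ψ(a/q) + log q)/q` is algebraic -/

/-- **Murty–Saradha 2010, Theorem 1.** «At most one number in the infinite list
`γ(a,q)`, `1 ≤ a < q`, `q ≥ 2`, is an algebraic number»: with `γ(a,q) = −(ψ(a/q) + log q)/q`
(Lehmer; tree `EulerLehmer.tendsto_sum_inv_sub_log_div`), if `γ(a,q)` and `γ(b,r)` are both
algebraic then `(a,q) = (b,r)`. [cite: MurtySaradha2010, Theorem 1] -/
theorem eq_of_isAlgebraic_eulerLehmer {a q b r : ℕ} (ha : 1 ≤ a) (haq : a < q) (hb : 1 ≤ b)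
    (hbr : b < r) (h₁ : IsAlgebraic ℚ (-(Complex.digamma ((a : ℂ) / q) + Real.log q) / q))
    (h₂ : IsAlgebraic ℚ (-(Complex.digamma ((b : ℂ) / r) + Real.log r) / r)) : a = b ∧ q = r := by
  have hq : (q : ℂ) ≠ 0 := by exact_mod_cast (show q ≠ 0 by omega)
  have hr : (r : ℂ) ≠ 0 := by exact_mod_cast (show r ≠ 0 by omega)
  refine eq_of_isAlgebraic_eulerLehmerStar_sub ha haq hb hbr ?_
  have e : -(Complex.digamma ((a : ℂ) / q) + Real.log q) - -(Complex.digamma ((b : ℂ) / r) + Real.log r) =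
      (q : ℂ) * (-(Complex.digamma ((a : ℂ) / q) + Real.log q) / q) -
        (r : ℂ) * (-(Complex.digamma ((b : ℂ) / r) + Real.log r) / r) := by
    field_simp
  rw [e]
  exact ((isAlgebraic_nat q).mul h₁).sub ((isAlgebraic_nat r).mul h₂)

/-- **Murty–Saradha 2010, Theorem 1, second clause.** «Further, if `γ` is algebraic, then only
the number `γ(2,4) = γ/4` from the above list is algebraic»: `γ` and `γ(a,q)` both algebraic
(`1 ≤ a < q`) force `(a,q) = (2,4)`. [cite: MurtySaradha2010, Theorem 1] -/
theorem eq_two_four_of_isAlgebraic {a q : ℕ} (ha : 1 ≤ a) (haq : a < q)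
    (hγ : IsAlgebraic ℚ (Real.eulerMascheroniConstant : ℂ))
    (h : IsAlgebraic ℚ (-(Complex.digamma ((a : ℂ) / q) + Real.log q) / q)) : a = 2 ∧ q = 4 := by
  have hq : (q : ℂ) ≠ 0 := by exact_mod_cast (show q ≠ 0 by omega)
  refine eq_two_four_of_isAlgebraic_digamma_add ha haq ?_
  have e : Complex.digamma ((a : ℂ) / q) + Real.eulerMascheroniConstant + Real.log q =
      Real.eulerMascheroniConstant - (q : ℂ) * (-(Complex.digamma ((a : ℂ) / q) + Real.log q) / q) := by
    field_simp; ring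
  rw [e]
  exact hγ.sub ((isAlgebraic_nat q).mul h)

/-- `γ(2,4) = −(ψ(2/4) + log 4)/4 = γ/4` (so that, were `γ` algebraic, `γ(2,4)` would be the one
algebraic number of the list). [cite: MurtySaradha2010, §1 («It follows easily that γ(2,4) = γ/4»)] -/
theorem eulerLehmer_two_four :
    -(Complex.digamma (((2 : ℕ) : ℂ) / (4 : ℕ)) + Real.log (4 : ℕ)) / (4 : ℕ) =
      (Real.eulerMascheroniConstant : ℂ) / 4 := by
  rw [(eulerLehmerStar_eq_eulerMascheroni_iff (a := 2) (q := 4) (by norm_num) (by norm_num)).2 ⟨rfl, rfl⟩]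
  push_cast
  ring

/-- **Theorem 1 in the printed shape (limits).** For `1 ≤ a < q`, `1 ≤ b < r`: if the Euler–Lehmer
sequences `Σ_{n ≤ M, n ≡ a (q)} 1/n − (log M)/q` and `Σ_{n ≤ M, n ≡ b (r)} 1/n − (log M)/r` converge
to ALGEBRAIC numbers `x`, `y`, then `(a,q) = (b,r)` (their limits are `−(ψ(a/q) + log q)/q`,
`−(ψ(b/r) + log r)/r`, `EulerLehmer.tendsto_sum_inv_sub_log_div`). [cite: MurtySaradha2010, Theorem 1] -/
theorem eq_of_tendsto_of_isAlgebraic {a q b r : ℕ} (ha : 1 ≤ a) (haq : a < q) (hb : 1 ≤ b)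
    (hbr : b < r) {x y : ℂ}
    (hx : Tendsto (fun M : ℕ => (∑ n ∈ (Icc 1 M).filter (fun n => n ≡ a [MOD q]), (1 : ℂ) / n) -
      (Real.log M : ℂ) / q) atTop (𝓝 x))
    (hy : Tendsto (fun M : ℕ => (∑ n ∈ (Icc 1 M).filter (fun n => n ≡ b [MOD r]), (1 : ℂ) / n) -
      (Real.log M : ℂ) / r) atTop (𝓝 y))
    (hxa : IsAlgebraic ℚ x) (hya : IsAlgebraic ℚ y) : a = b ∧ q = r := by
  have hx' := Literature.NumberTheory.LFunctions.EulerLehmer.tendsto_sum_inv_sub_log_div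
    (Finset.mem_Icc.2 ⟨ha, haq.le⟩)
  have hy' := Literature.NumberTheory.LFunctions.EulerLehmer.tendsto_sum_inv_sub_log_div
    (Finset.mem_Icc.2 ⟨hb, hbr.le⟩)
  rw [tendsto_nhds_unique hx hx'] at hxa
  rw [tendsto_nhds_unique hy hy'] at hya
  exact eq_of_isAlgebraic_eulerLehmer ha haq hb hbr hxa hya

/-! ### The digamma statements of §4, for every `1 ≤ a < q` -/

/-- **`ψ(a/q) + γ` is transcendental for every `1 ≤ a < q`** (no coprimality hypothesis): were it
algebraic, the one-point engine would give `a/q = 1/2` and `ψ(1/2) + γ = 0`, against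
`ψ(1/2) + γ = −log 4`. (Murty–Saradha 2007 / Murty–Rath Thm 22.8 state it for `(a,q) = 1`; the
tree's `BakerBirchWirsing.transcendental_digamma_add_eulerMascheroni` is that form.)
[cite: MurtySaradha2010, §4 (proof of Corollary 2)] -/
theorem transcendental_digamma_add_eulerMascheroni' {a q : ℕ} (ha : 1 ≤ a) (haq : a < q) :
    Transcendental ℚ (Complex.digamma ((a : ℂ) / q) + Real.eulerMascheroniConstant) := by
  intro h
  have hq : 0 < q := by omega
  rw [digamma_div_natCast' ha hq] at h
  have h' : IsAlgebraic ℚ (((digammaReal (a / q) + Real.eulerMascheroniConstant + (0 : ℝ) * Real.log q : ℝ) : ℂ)) := by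
    convert h using 1; push_cast; ring
  have hR := (isAlgebraic_algebraMap_iff (R := ℚ) (A := ℂ) Complex.ofReal_injective).mp h'
  obtain ⟨h2, h0⟩ := two_mul_eq_of_isAlgebraic ha haq isAlgebraic_zero hR
  have hhalf : (a : ℝ) / q = (1 : ℕ) / (2 : ℕ) := by
    rw [div_eq_div_iff (by exact_mod_cast hq.ne') (by norm_num)]
    exact_mod_cast (by omega : a * 2 = 1 * q)
  rw [hhalf, zero_mul, add_zero] at h0
  have h4 : Real.log 4 = 0 := by linarith [digammaReal_half_add]
  have : (4 : ℝ) = 1 := Real.eq_one_of_pos_of_log_eq_zero (by norm_num) h4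
  norm_num at this

/-- **`ψ(a/q) − ψ(b/r)` algebraic forces `a/q = b/r`** (`1 ≤ a < q`, `1 ≤ b < r`; the two-point
engine with no logarithmic coefficients). [cite: MurtySaradha2010, §4 (proof of Corollary 2)] -/
theorem div_eq_div_of_isAlgebraic_digamma_sub {a q b r : ℕ} (ha : 1 ≤ a) (haq : a < q) (hb : 1 ≤ b)
    (hbr : b < r) (h : IsAlgebraic ℚ (Complex.digamma ((a : ℂ) / q) - Complex.digamma ((b : ℂ) / r))) :
    (a : ℝ) / q = b / r := by
  have hq : 0 < q := by omega
  have hr : 0 < r := by omega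
  rw [digamma_div_natCast' ha hq, digamma_div_natCast' hb hr] at h
  have h' : IsAlgebraic ℚ (((digammaReal (a / q) - digammaReal (b / r) + (0 : ℝ) * Real.log q +
      (0 : ℝ) * Real.log r : ℝ) : ℂ)) := by
    convert h using 1; push_cast; ring
  have hR := (isAlgebraic_algebraMap_iff (R := ℚ) (A := ℂ) Complex.ofReal_injective).mp h'
  exact (div_eq_div_of_isAlgebraic ha haq hb hbr isAlgebraic_zero isAlgebraic_zero hR).1

/-- **`ψ(a/q) − ψ(b/r)` is transcendental unless `a/q = b/r`** — so at most one of the numbers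
`ψ(x)`, `x ∈ ℚ ∩ (0,1)`, is algebraic, and (with `transcendental_digamma_add_eulerMascheroni'`) at
most one of `γ, ψ(x)` (Chatterjee–Gun 2014, Thm 1.2, all moduli at once).
[cite: MurtySaradha2010, §4 (proof of Corollary 2)] -/
theorem transcendental_digamma_sub_digamma' {a q b r : ℕ} (ha : 1 ≤ a) (haq : a < q) (hb : 1 ≤ b)
    (hbr : b < r) (hne : (a : ℝ) / q ≠ b / r) :
    Transcendental ℚ (Complex.digamma ((a : ℂ) / q) - Complex.digamma ((b : ℂ) / r)) :=
  fun h => hne (div_eq_div_of_isAlgebraic_digamma_sub ha haq hb hbr h)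

/-! ### Corollary 2: `Γ(x)` and `Γ′(x)` at rationals `0 < x ≤ 1` -/

/-- `ψ(x) = Γ′(x)/Γ(x)` for real `x > 0` (`digammaReal` and Mathlib's real `Γ`). [folklore] -/
private theorem digammaReal_eq_deriv_div {x : ℝ} (hx : 0 < x) :
    digammaReal x = deriv Real.Gamma x / Real.Gamma x := by
  rw [(hasDerivAt_Gamma_digammaReal hx).deriv, mul_div_cancel_left₀ _ (Real.Gamma_pos_of_pos hx).ne']

/-- If `Γ(x)` and `Γ′(x)` are algebraic (`x > 0` real) then so is `ψ(x) = Γ′(x)/Γ(x)`. [folklore] -/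
private theorem isAlgebraic_digammaReal {x : ℝ} (hx : 0 < x) (h₁ : IsAlgebraic ℚ (Real.Gamma x))
    (h₂ : IsAlgebraic ℚ (deriv Real.Gamma x)) : IsAlgebraic ℚ (digammaReal x) := by
  rw [digammaReal_eq_deriv_div hx, div_eq_mul_inv]
  exact h₂.mul h₁.inv

/-- `ψ(1) = −γ` for the real digamma. [folklore] -/
private theorem digammaReal_one' : digammaReal 1 = -Real.eulerMascheroniConstant := by
  have h : Complex.digamma ((1 : ℝ) : ℂ) = ((digammaReal 1 : ℝ) : ℂ) :=
    Literature.NumberTheory.Automorphic.LegendreP.digamma_ofReal_eq_digammaReal one_pos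
  rw [Complex.ofReal_one, Complex.digamma_one] at h
  exact_mod_cast h.symm

/-- **Murty–Saradha 2010, Corollary 2 (numerators and denominators).** For `1 ≤ a ≤ q` and
`1 ≤ b ≤ r`: if `Γ(a/q)`, `Γ′(a/q)`, `Γ(b/r)`, `Γ′(b/r)` are all algebraic then `a/q = b/r` — «at
least one of `Γ(x)`, `Γ′(x)` is transcendental, with at most one possible exceptional `x`».
[cite: MurtySaradha2010, Corollary 2] -/
theorem eq_of_isAlgebraic_Gamma_deriv_Gamma {a q b r : ℕ} (ha : 1 ≤ a) (haq : a ≤ q) (hb : 1 ≤ b)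
    (hbr : b ≤ r) (h₁ : IsAlgebraic ℚ (Real.Gamma (a / q)))
    (h₁' : IsAlgebraic ℚ (deriv Real.Gamma (a / q))) (h₂ : IsAlgebraic ℚ (Real.Gamma (b / r)))
    (h₂' : IsAlgebraic ℚ (deriv Real.Gamma (b / r))) : (a : ℝ) / q = b / r := by
  have hq : 0 < q := by omega
  have hr : 0 < r := by omega
  have hqR : (0 : ℝ) < q := by exact_mod_cast hq
  have hrR : (0 : ℝ) < r := by exact_mod_cast hr
  have hxa : (0 : ℝ) < a / q := div_pos (by exact_mod_cast ha) hqR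
  have hxb : (0 : ℝ) < b / r := div_pos (by exact_mod_cast hb) hrR
  have hψa := isAlgebraic_digammaReal hxa h₁ h₁'
  have hψb := isAlgebraic_digammaReal hxb h₂ h₂'
  -- `x = 1` exactly when the numerator equals the denominator
  have hone : ∀ {c s : ℕ}, 0 < s → c = s → (c : ℝ) / s = 1 := fun hs hcs => by
    rw [hcs, div_self (by exact_mod_cast hs.ne')]
  -- an exceptional `x < 1` makes `γ` transcendental-with-`ψ(x)` impossible when the other is `1`
  have key : ∀ {c s : ℕ}, 1 ≤ c → c < s → IsAlgebraic ℚ (digammaReal (c / s)) →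
      ¬ IsAlgebraic ℚ Real.eulerMascheroniConstant := by
    intro c s hc hcs hψ hγ
    have hs : 0 < s := by omega
    refine transcendental_digamma_add_eulerMascheroni' hc hcs ?_
    rw [digamma_div_natCast' hc hs]
    exact_mod_cast (hψ.add hγ).algebraMap
  rcases haq.lt_or_eq with haq | haq <;> rcases hbr.lt_or_eq with hbr | hbr
  · -- both `< 1`: the two-point engine
    refine div_eq_div_of_isAlgebraic_digamma_sub ha haq hb hbr ?_
    rw [digamma_div_natCast' ha hq, digamma_div_natCast' hb hr]
    exact_mod_cast (hψa.sub hψb).algebraMap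
  · -- `b/r = 1`: `ψ(1) = −γ` algebraic, contradiction with `ψ(a/q) + γ` transcendental
    exfalso
    rw [hone hr hbr, digammaReal_one'] at hψb
    exact key ha haq hψa (by simpa using hψb.neg)
  · exfalso
    rw [hone hq haq, digammaReal_one'] at hψa
    exact key hb hbr hψb (by simpa using hψa.neg)
  · rw [hone hq haq, hone hr hbr]

/-- **Murty–Saradha 2010, Corollary 2 (as printed, over `ℚ`).** «As `x` ranges over all rational
numbers with `0 < x ≤ 1`, at least one of `Γ(x)`, `Γ′(x)` is transcendental, with at most one
possible exceptional `x`»: two exceptional rationals coincide. [cite: MurtySaradha2010, Corollary 2] -/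
theorem eq_of_isAlgebraic_Gamma_deriv_Gamma_rat {x y : ℚ} (hx : 0 < x) (hx1 : x ≤ 1) (hy : 0 < y)
    (hy1 : y ≤ 1) (h₁ : IsAlgebraic ℚ (Real.Gamma x)) (h₁' : IsAlgebraic ℚ (deriv Real.Gamma x))
    (h₂ : IsAlgebraic ℚ (Real.Gamma y)) (h₂' : IsAlgebraic ℚ (deriv Real.Gamma y)) : x = y := by
  -- numerators and denominators
  have hrepr : ∀ {z : ℚ}, 0 < z → z ≤ 1 →
      1 ≤ z.num.toNat ∧ z.num.toNat ≤ z.den ∧ ((z : ℝ) = (z.num.toNat : ℝ) / z.den) := by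
    intro z hz hz1
    have hn : 0 < z.num := Rat.num_pos.2 hz
    have hnat : ((z.num.toNat : ℕ) : ℤ) = z.num := Int.toNat_of_nonneg hn.le
    refine ⟨?_, ?_, ?_⟩
    · omega
    · have := Rat.num_le_denom_iff.2 hz1
      omega
    · rw [Rat.cast_def, show ((z.num.toNat : ℕ) : ℝ) = ((z.num.toNat : ℤ) : ℝ) by norm_cast, hnat]
  obtain ⟨ha, haq, hxe⟩ := hrepr hx hx1
  obtain ⟨hb, hbr, hye⟩ := hrepr hy hy1
  rw [hxe] at h₁ h₁'
  rw [hye] at h₂ h₂'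
  have h := eq_of_isAlgebraic_Gamma_deriv_Gamma ha haq hb hbr h₁ h₁' h₂ h₂'
  rw [← hxe, ← hye] at h
  exact_mod_cast h

end MurtySaradha2010

end Literature.NumberTheory.Transcendental
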